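import Mathlib
import Literature.NumberTheory.LFunctions.RationalExpSumNewton
import HarnessLib

/-!
# The root sums `Σ_{h(β)=0} P(β)/Q(β)` depend only on `deg h` and `h mod Q²`

Topic `Literature/NumberTheory/LFunctions` (exponential sums), grouping namespace
`RationalExpSum` (third file of the elementary treatment of Weil's bound for rational-function
exponential sums; see `RationalExpSumNewton`, `RationalExpSumLFunction`).  Over an algebraically
closed field `L ⊇ F`, for `P, Q ∈ F[X]` with `deg P ≤ deg Q` we consider

* `rootSum P Q L h = Σ_{β ∈ roots of h in L} P(β)/Q(β)` (with multiplicity) — the image in `L`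
  of Schmidt's `[R/h]`, `R = P/Q`; additive in `h` (`rootSum_mul`);

and PROVE the **invariance theorem** (`rootSum_eq_of_sq_dvd_sub`): for monic `h₁, h₂ ∈ F[X]`
of the SAME degree, both coprime to `Q`, with `Q² ∣ h₁ − h₂`, `rootSum P Q L h₁ = rootSum P Q L h₂`.
Proof: partial fractions of `P/Q` over `L` (Mathlib's
`Polynomial.eq_quo_mul_prod_pow_add_sum_rem_mul_prod_pow` for the pairwise coprime `X − γ`,
`γ` the roots of `Q`): `P(β)/Q(β) = lc(Q)⁻¹ (q₀ + Σ_{γ, j} c_{γ,j} (β − γ)^{−(m_γ − j)})` with a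
CONSTANT polynomial part `q₀` (as `deg P ≤ deg Q`), so
`rootSum h = lc⁻¹ (q₀ deg h + Σ c_{γ,j} u_{m_γ−j}(h, γ))` with the inverse power sums
`u_s(h, γ) = Σ_{h(β)=0} (β − γ)^{−s}` of `RationalExpSumNewton`, which for `s ≤ m_γ` are determined
by `h mod (X − γ)^{m_γ+1}`, hence by `h mod Q²` (`invPowerSum_eq_of_dvd_sub`).  This is the
algebraic content of the statement that `h ↦ ψ([R/h])` is a character modulo `Q · rad Q`
(here, more crudely, modulo `Q²`).

Everything is proved; no named facts.

## References

* W. M. Schmidt, *Equations over Finite Fields. An Elementary Approach*, LNM 536 (1976),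
  Ch. II §§6, 9. [`Schmidt1976`]
* A. Weil, *On some exponential sums*, Proc. Nat. Acad. Sci. USA 34 (1948) 204–207. [`Weil1948`]
-/

noncomputable section

open Finset Polynomial

namespace Literature.NumberTheory.LFunctions

namespace RationalExpSum

/-! ### §1. The root sums -/

section RootSum

variable {F : Type*} [Field F] (L : Type*) [Field L] [Algebra F L]

/-- **The root sum** `Σ_{β ∈ roots of h in L} P(β)/Q(β)`, roots with multiplicity (the image in
`L` of Schmidt's `[R/h] = Σ_{h(β)=0} R(β)` for the rational function `R = P/Q`).
[cite: Schmidt1976, Ch. II §9, p. 64] -/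
def rootSum (P Q : F[X]) (h : F[X]) : L :=
  ((h.map (algebraMap F L)).roots.map fun β => aeval β P / aeval β Q).sum

variable {L}

/-- Additivity: `rootSum (h₁ h₂) = rootSum h₁ + rootSum h₂` for `h₁, h₂ ≠ 0`. [cite: Schmidt1976, Ch. II §9, Lemma 9A] -/
theorem rootSum_mul (P Q : F[X]) {h₁ h₂ : F[X]} (h₁0 : h₁ ≠ 0) (h₂0 : h₂ ≠ 0) :
    rootSum L P Q (h₁ * h₂) = rootSum L P Q h₁ + rootSum L P Q h₂ := by
  unfold rootSum
  have h0 : h₁.map (algebraMap F L) * h₂.map (algebraMap F L) ≠ 0 :=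
    mul_ne_zero ((Polynomial.map_ne_zero_iff (algebraMap F L).injective).mpr h₁0)
      ((Polynomial.map_ne_zero_iff (algebraMap F L).injective).mpr h₂0)
  rw [Polynomial.map_mul, roots_mul h0, Multiset.map_add, Multiset.sum_add]

/-- `rootSum 1 = 0`. [folklore] -/
theorem rootSum_one (P Q : F[X]) : rootSum L P Q 1 = 0 := by
  unfold rootSum; simp

/-- Additivity over a multiset product of non-zero polynomials. [folklore] -/
theorem rootSum_multiset_prod (P Q : F[X]) (s : Multiset F[X]) (hs : ∀ h ∈ s, h ≠ 0) :
    rootSum L P Q s.prod = (s.map (rootSum L P Q)).sum := by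
  induction s using Multiset.induction_on with
  | empty => simp [rootSum_one]
  | cons a s ih =>
    rw [Multiset.prod_cons, Multiset.map_cons, Multiset.sum_cons,
      rootSum_mul P Q (hs a (Multiset.mem_cons_self a s))
        (Multiset.prod_ne_zero fun h0 => hs 0 (Multiset.mem_cons_of_mem h0) rfl),
      ih fun h hh => hs h (Multiset.mem_cons_of_mem hh)]

end RootSum

/-! ### §2. Partial fractions: `P(β)/Q(β)` as a combination of the `(β − γ)^{−s}` -/

section PartialFractions

variable {L : Type*} [Field L] [DecidableEq L]

/-- **Partial fractions of `P/Q` at the non-poles**, for `Q ≠ 0` splitting over `L` and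
`deg P ≤ deg Q`: there are a constant `q₀` and constants `c γ j` (`γ` a root of `Q` of
multiplicity `m_γ`, `j < m_γ`) with
`P(β)/Q(β) = lc(Q)⁻¹ (q₀ + Σ_γ Σ_{j<m_γ} c γ j · ((β − γ)⁻¹)^{m_γ − j})` for every `β` with
`Q(β) ≠ 0`. [folklore] -/
theorem exists_partialFraction_eval {P Q : L[X]} (hQ0 : Q ≠ 0)
    (hsplit : Q.roots.card = Q.natDegree) (hPQ : P.natDegree ≤ Q.natDegree) :
    ∃ (q₀ : L) (c : L → (j : ℕ) → L), ∀ β : L, Q.eval β ≠ 0 →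
      P.eval β / Q.eval β = Q.leadingCoeff⁻¹ *
        (q₀ + ∑ γ ∈ Q.roots.toFinset, ∑ j ∈ Finset.range (Q.roots.count γ),
          c γ j * ((β - γ)⁻¹) ^ (Q.roots.count γ - j)) := by
  set s : Finset L := Q.roots.toFinset with hs
  set m : L → ℕ := fun γ => Q.roots.count γ with hm
  set D : L[X] := ∏ γ ∈ s, (X - C γ) ^ m γ with hD
  have hDm : D.Monic := monic_prod_of_monic _ _ fun γ _ => (monic_X_sub_C γ).pow _
  -- `Q = lc · D`
  have hQD : Q = C Q.leadingCoeff * D := by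
    conv_lhs => rw [← C_leadingCoeff_mul_prod_multiset_X_sub_C hsplit]
    rw [hD, Finset.prod_multiset_map_count]
  have hlc : Q.leadingCoeff ≠ 0 := leadingCoeff_ne_zero.mpr hQ0
  have hDdeg : D.natDegree = Q.natDegree := by
    have := congrArg natDegree hQD
    rw [natDegree_C_mul hlc] at this
    exact this.symm
  -- partial fractions
  obtain ⟨q, r, hr, hPF⟩ := eq_quo_mul_prod_pow_add_sum_rem_mul_prod_pow (s := s) P
    (g := fun γ => X - C γ) (fun γ _ => monic_X_sub_C γ)
    (fun γ _ γ' _ hne => pairwise_coprime_X_sub_C (s := id) (fun _ _ h => h) hne) m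
  -- the remainders are constants
  have hrC : ∀ γ ∈ s, ∀ j : Fin (m γ), r γ j = C ((r γ j).coeff 0) := by
    intro γ hγ j
    apply eq_C_of_degree_le_zero
    have := hr γ hγ j
    rw [degree_X_sub_C] at this
    exact Order.le_of_lt_succ this
  -- the sum part has degree `< deg Q`
  set Ssum : L[X] := ∑ γ ∈ s, ∑ j : Fin (m γ), r γ j * (X - C γ) ^ (j : ℕ) *
    ∏ k ∈ s.erase γ, (X - C k) ^ m k with hSsum
  have hterm_deg : ∀ γ ∈ s, ∀ j : Fin (m γ),
      (r γ j * (X - C γ) ^ (j : ℕ) * ∏ k ∈ s.erase γ, (X - C k) ^ m k).natDegree < Q.natDegree := by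
    intro γ hγ j
    have hprod : (∏ k ∈ s.erase γ, (X - C k) ^ m k).natDegree = ∑ k ∈ s.erase γ, m k := by
      rw [natDegree_prod_of_monic _ _ fun k _ => (monic_X_sub_C k).pow _]
      exact Finset.sum_congr rfl fun k _ => by rw [natDegree_pow, natDegree_X_sub_C, mul_one]
    have hDsum : Q.natDegree = ∑ k ∈ s, m k := by
      rw [← hDdeg, hD, natDegree_prod_of_monic _ _ fun k _ => (monic_X_sub_C k).pow _]
      exact Finset.sum_congr rfl fun k _ => by rw [natDegree_pow, natDegree_X_sub_C, mul_one]
    have herase : ∑ k ∈ s.erase γ, m k + m γ = ∑ k ∈ s, m k := Finset.sum_erase_add _ _ hγ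
    calc (r γ j * (X - C γ) ^ (j : ℕ) * ∏ k ∈ s.erase γ, (X - C k) ^ m k).natDegree
        ≤ (r γ j * (X - C γ) ^ (j : ℕ)).natDegree + (∏ k ∈ s.erase γ, (X - C k) ^ m k).natDegree :=
          natDegree_mul_le
      _ ≤ (0 + j) + ∑ k ∈ s.erase γ, m k := by
          rw [hprod]
          refine Nat.add_le_add (natDegree_mul_le.trans (Nat.add_le_add ?_ ?_)) le_rfl
          · rw [hrC γ hγ j, natDegree_C]
          · rw [natDegree_pow, natDegree_X_sub_C, mul_one]
      _ < Q.natDegree := by rw [hDsum, ← herase]; have := j.is_lt; omega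
  have hSdeg : Ssum.natDegree < Q.natDegree ∨ Ssum = 0 := by
    by_cases h0 : Ssum = 0
    · exact Or.inr h0
    · left
      have hQpos : 0 < Q.natDegree := by
        rcases Nat.eq_zero_or_pos Q.natDegree with hz | hz
        · -- then `s` is empty and `Ssum = 0`
          exfalso
          rw [← hsplit, Multiset.card_eq_zero] at hz
          apply h0
          rw [hSsum, hs, hz]
          simp
        · exact hz
      rw [hSsum]
      refine lt_of_le_of_lt (natDegree_sum_le_of_forall_le _ _ fun γ hγ => ?_) (Nat.sub_one_lt_of_lt hQpos)
      refine natDegree_sum_le_of_forall_le _ _ fun j _ => ?_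
      exact Nat.le_sub_one_of_lt (hterm_deg γ hγ j)
  -- hence `q` is a constant
  have hqC : q = C (q.coeff 0) := by
    apply eq_C_of_natDegree_eq_zero
    by_contra hq
    have hq0 : q ≠ 0 := by rintro rfl; exact hq natDegree_zero
    have h1 : (q * D).natDegree = q.natDegree + Q.natDegree := by
      rw [natDegree_mul hq0 hDm.ne_zero, hDdeg]
    have h2 : q * D = P - Ssum := by rw [hPF, hSsum, hD]; ring
    have h3 : (P - Ssum).natDegree ≤ Q.natDegree := by
      refine (natDegree_sub_le _ _).trans (max_le hPQ ?_)
      rcases hSdeg with h | h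
      · exact h.le
      · rw [h, natDegree_zero]; exact Nat.zero_le _
    rw [← h2, h1] at h3
    omega
  refine ⟨q.coeff 0, fun γ j => if hj : j < m γ then (r γ ⟨j, hj⟩).coeff 0 else 0, ?_⟩
  intro β hβ
  -- `β` is not a root: all `β − γ ≠ 0`, `D(β) ≠ 0`
  have hβγ : ∀ γ ∈ s, β - γ ≠ 0 := by
    intro γ hγ h0
    rw [sub_eq_zero] at h0
    rw [hs, Multiset.mem_toFinset, mem_roots hQ0] at hγ
    rw [h0] at hβ
    exact hβ hγ
  have hDβ : D.eval β = ∏ γ ∈ s, (β - γ) ^ m γ := by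
    rw [hD, eval_prod]; simp
  have hDβ0 : D.eval β ≠ 0 := by
    rw [hDβ]; exact Finset.prod_ne_zero_iff.mpr fun γ hγ => pow_ne_zero _ (hβγ γ hγ)
  -- evaluate the partial fraction identity at `β`
  have hPβ : P.eval β = q.coeff 0 * D.eval β + ∑ γ ∈ s, ∑ j : Fin (m γ),
      (r γ j).coeff 0 * (β - γ) ^ (j : ℕ) * ∏ k ∈ s.erase γ, (β - k) ^ m k := by
    have := congrArg (eval β) hPF
    rw [eval_add, eval_mul, eval_finsetSum] at this
    rw [this, ← hD]
    conv_lhs => rw [hqC]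
    rw [eval_C]
    congr 1
    refine Finset.sum_congr rfl fun γ hγ => ?_
    rw [eval_finsetSum]
    refine Finset.sum_congr rfl fun j _ => ?_
    rw [hrC γ hγ j, eval_mul, eval_mul, eval_C, eval_pow, eval_sub, eval_X, eval_C, eval_prod]
    simp
  -- `Π_{k ≠ γ} (β − k)^{m_k} = D(β) · ((β − γ)⁻¹)^{m_γ}`
  have herase : ∀ γ ∈ s, ∏ k ∈ s.erase γ, (β - k) ^ m k = D.eval β * ((β - γ)⁻¹) ^ m γ := by
    intro γ hγ
    rw [hDβ, ← Finset.mul_prod_erase s (fun k => (β - k) ^ m k) hγ, inv_pow]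
    field_simp [pow_ne_zero _ (hβγ γ hγ)]
  have hQβ : Q.eval β = Q.leadingCoeff * D.eval β := by
    conv_lhs => rw [hQD]
    rw [eval_mul, eval_C]
  have hsum : ∑ γ ∈ s, ∑ j : Fin (m γ), (r γ j).coeff 0 * (β - γ) ^ (j : ℕ) *
      ∏ k ∈ s.erase γ, (β - k) ^ m k =
      D.eval β * ∑ γ ∈ s, ∑ j ∈ Finset.range (m γ),
        (if hj : j < m γ then (r γ ⟨j, hj⟩).coeff 0 else 0) * ((β - γ)⁻¹) ^ (m γ - j) := by
    rw [Finset.mul_sum]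
    refine Finset.sum_congr rfl fun γ hγ => ?_
    rw [Finset.mul_sum, ← Fin.sum_univ_eq_sum_range]
    refine Finset.sum_congr rfl fun j _ => ?_
    rw [dif_pos j.is_lt, herase γ hγ]
    have hne := hβγ γ hγ
    have hj := j.is_lt
    -- `(β − γ)^j · ((β−γ)⁻¹)^{m} = ((β − γ)⁻¹)^{m − j}`
    have hpow : (β - γ) ^ (j : ℕ) * ((β - γ)⁻¹) ^ m γ = ((β - γ)⁻¹) ^ (m γ - j) := by
      calc (β - γ) ^ (j : ℕ) * ((β - γ)⁻¹) ^ m γ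
          = (β - γ) ^ (j : ℕ) * (((β - γ)⁻¹) ^ (j : ℕ) * ((β - γ)⁻¹) ^ (m γ - j)) := by
            rw [← pow_add, Nat.add_sub_cancel' hj.le]
        _ = ((β - γ) * (β - γ)⁻¹) ^ (j : ℕ) * ((β - γ)⁻¹) ^ (m γ - j) := by rw [mul_pow]; ring
        _ = ((β - γ)⁻¹) ^ (m γ - j) := by rw [mul_inv_cancel₀ hne, one_pow, one_mul]
    calc (r γ j).coeff 0 * (β - γ) ^ (j : ℕ) * (D.eval β * ((β - γ)⁻¹) ^ m γ)
        = (r γ j).coeff 0 * D.eval β * ((β - γ) ^ (j : ℕ) * ((β - γ)⁻¹) ^ m γ) := by ring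
      _ = D.eval β * ((r γ j).coeff 0 * ((β - γ)⁻¹) ^ (m γ - j)) := by rw [hpow]; ring
  rw [hQβ, hPβ, hsum]
  field_simp
  ring

end PartialFractions


/-! ### §3. The invariance theorem -/

section Invariance

variable {F : Type*} [Field F] {L : Type*} [Field L] [Algebra F L] [DecidableEq L]

/-- Pushing a multiset sum through a finite sum. [folklore] -/
theorem multiset_sum_map_finset_sum {ι κ M : Type*} [AddCommMonoid M] [DecidableEq κ]
    (m : Multiset ι) (t : Finset κ) (f : ι → κ → M) :
    (m.map fun a => ∑ x ∈ t, f a x).sum = ∑ x ∈ t, (m.map fun a => f a x).sum := by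
  induction t using Finset.induction_on with
  | empty => simp
  | insert x t hx ih =>
    simp only [Finset.sum_insert hx]
    rw [Multiset.sum_map_add, ih]

omit [DecidableEq L] in
/-- A common root contradicts coprimality. [folklore] -/
theorem eval_ne_zero_of_isCoprime {A B : L[X]} (h : IsCoprime A B) {β : L} (hA : A.eval β = 0) :
    B.eval β ≠ 0 := by
  intro hB
  obtain ⟨a, b, hab⟩ := h
  have := congrArg (eval β) hab
  rw [eval_add, eval_mul, eval_mul, hA, hB, mul_zero, mul_zero, add_zero, eval_one] at this
  exact zero_ne_one this

/-- **The root sum in partial-fraction form**: for monic `h` coprime to `Q` (`Q ≠ 0`,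
`deg P ≤ deg Q`), with `q₀, c` the partial-fraction data of `P/Q` over `L`,
`rootSum h = lc(Q)⁻¹ (deg h · q₀ + Σ_γ Σ_{j<m_γ} c γ j · u_{m_γ−j}(h, γ))`. [folklore] -/
theorem rootSum_eq_of_partialFraction [IsAlgClosed L] {P Q : F[X]}
    {q₀ : L} {c : L → ℕ → L}
    (hPF : ∀ β : L, (Q.map (algebraMap F L)).eval β ≠ 0 →
      (P.map (algebraMap F L)).eval β / (Q.map (algebraMap F L)).eval β =
        (Q.map (algebraMap F L)).leadingCoeff⁻¹ *
          (q₀ + ∑ γ ∈ (Q.map (algebraMap F L)).roots.toFinset,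
            ∑ j ∈ Finset.range ((Q.map (algebraMap F L)).roots.count γ),
              c γ j * ((β - γ)⁻¹) ^ ((Q.map (algebraMap F L)).roots.count γ - j)))
    {h : F[X]} (hm : h.Monic) (hcop : IsCoprime h Q) :
    rootSum L P Q h = (Q.map (algebraMap F L)).leadingCoeff⁻¹ *
      ((h.natDegree : L) * q₀ + ∑ γ ∈ (Q.map (algebraMap F L)).roots.toFinset,
        ∑ j ∈ Finset.range ((Q.map (algebraMap F L)).roots.count γ),
          c γ j * invPowerSum (h.map (algebraMap F L)) γ ((Q.map (algebraMap F L)).roots.count γ - j)) := by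
  set ι := algebraMap F L with hι
  set Qt := Q.map ι with hQt
  set ht := h.map ι with hht
  have hcop' : IsCoprime ht Qt := (isCoprime_map ι).mpr hcop
  have hsplit : ht.roots.card = ht.natDegree := splits_iff_card_roots.mp (IsAlgClosed.splits ht)
  have hdeg : ht.natDegree = h.natDegree := hm.natDegree_map ι
  -- each root `β` of `h` is a non-pole, and the summand is given by the partial fractions
  have hterm : ∀ β ∈ ht.roots, aeval β P / aeval β Q = Qt.leadingCoeff⁻¹ *
      (q₀ + ∑ γ ∈ Qt.roots.toFinset, ∑ j ∈ Finset.range (Qt.roots.count γ),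
        c γ j * ((β - γ)⁻¹) ^ (Qt.roots.count γ - j)) := by
    intro β hβ
    have hroot : ht.eval β = 0 := (mem_roots'.mp hβ).2
    have hQβ : Qt.eval β ≠ 0 := eval_ne_zero_of_isCoprime hcop' hroot
    rw [← eval_map_algebraMap, ← eval_map_algebraMap]
    exact hPF β hQβ
  unfold rootSum
  rw [Multiset.map_congr rfl hterm, Multiset.sum_map_mul_left, Multiset.sum_map_add]
  congr 2
  · rw [Multiset.map_const', Multiset.sum_replicate, nsmul_eq_mul, hsplit, hdeg]
  · rw [multiset_sum_map_finset_sum]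
    refine Finset.sum_congr rfl fun γ _ => ?_
    rw [multiset_sum_map_finset_sum]
    refine Finset.sum_congr rfl fun j _ => ?_
    rw [Multiset.sum_map_mul_left]
    rfl

/-- **Invariance of the root sums** (the algebraic heart of "`h ↦ ψ([R/h])` is a character modulo
`Q · rad Q`", here modulo `Q²`): for `Q ≠ 0`, `deg P ≤ deg Q`, and monic `h₁, h₂` of the same
degree, both coprime to `Q`, with `Q² ∣ h₁ − h₂`: `rootSum h₁ = rootSum h₂`.
[cite: Schmidt1976, Ch. II §9 (Lemma 9B-type vanishing, for rational arguments)] -/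
theorem rootSum_eq_of_sq_dvd_sub [IsAlgClosed L] {P Q : F[X]} (hQ0 : Q ≠ 0)
    (hPQ : P.natDegree ≤ Q.natDegree) {h₁ h₂ : F[X]} (hm₁ : h₁.Monic) (hm₂ : h₂.Monic)
    (hdeg : h₁.natDegree = h₂.natDegree) (hc₁ : IsCoprime h₁ Q) (hc₂ : IsCoprime h₂ Q)
    (hdvd : Q ^ 2 ∣ h₁ - h₂) : rootSum L P Q h₁ = rootSum L P Q h₂ := by
  set ι := algebraMap F L with hι
  set Qt := Q.map ι with hQt
  have hQt0 : Qt ≠ 0 := (Polynomial.map_ne_zero_iff ι.injective).mpr hQ0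
  have hsplitQ : Qt.roots.card = Qt.natDegree := splits_iff_card_roots.mp (IsAlgClosed.splits Qt)
  have hPQt : (P.map ι).natDegree ≤ Qt.natDegree := by
    rw [natDegree_map_eq_of_injective ι.injective, hQt, natDegree_map_eq_of_injective ι.injective]
    exact hPQ
  obtain ⟨q₀, c, hPF⟩ := exists_partialFraction_eval hQt0 hsplitQ hPQt
  rw [rootSum_eq_of_partialFraction hPF hm₁ hc₁, rootSum_eq_of_partialFraction hPF hm₂ hc₂,
    hdeg]
  congr 2
  refine Finset.sum_congr rfl fun γ hγ => Finset.sum_congr rfl fun j hj => ?_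
  congr 1
  -- the inverse power sums of order `≤ m_γ` agree: `(X − γ)^{m_γ+1} ∣ h̃₁ − h̃₂`
  rw [Multiset.mem_toFinset] at hγ
  rw [Finset.mem_range] at hj
  have hm1 : 1 ≤ Qt.roots.count γ := Multiset.one_le_count_iff_mem.mpr hγ
  have hsplit₁ : (h₁.map ι).roots.card = (h₁.map ι).natDegree :=
    splits_iff_card_roots.mp (IsAlgClosed.splits _)
  have hsplit₂ : (h₂.map ι).roots.card = (h₂.map ι).natDegree :=
    splits_iff_card_roots.mp (IsAlgClosed.splits _)
  have hQγ : Qt.eval γ = 0 := (mem_roots hQt0).mp hγ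
  have hγ₁ : (h₁.map ι).eval γ ≠ 0 := eval_ne_zero_of_isCoprime ((isCoprime_map ι).mpr hc₁).symm hQγ
  have hγ₂ : (h₂.map ι).eval γ ≠ 0 := eval_ne_zero_of_isCoprime ((isCoprime_map ι).mpr hc₂).symm hQγ
  have hdvd' : (X - C γ) ^ (Qt.roots.count γ + 1) ∣ h₁.map ι - h₂.map ι := by
    have h1 : (X - C γ) ^ Qt.roots.count γ ∣ Qt := by
      rw [count_roots]; exact pow_rootMultiplicity_dvd Qt γ
    have h2 : Qt ^ 2 ∣ h₁.map ι - h₂.map ι := by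
      rw [← Polynomial.map_sub, hQt, ← Polynomial.map_pow]; exact Polynomial.map_dvd ι hdvd
    calc (X - C γ) ^ (Qt.roots.count γ + 1) ∣ (X - C γ) ^ (2 * Qt.roots.count γ) :=
          pow_dvd_pow _ (by omega)
      _ = ((X - C γ) ^ Qt.roots.count γ) ^ 2 := by rw [← pow_mul, mul_comm]
      _ ∣ Qt ^ 2 := pow_dvd_pow_of_dvd h1 2
      _ ∣ _ := h2
  exact invPowerSum_eq_of_dvd_sub hsplit₁ hsplit₂ hγ₁ hγ₂ hdvd' _
    (Nat.le_sub_of_add_le (by rw [Nat.add_comm]; exact hj)) (Nat.sub_le _ _)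

end Invariance

end RationalExpSum

end Literature.NumberTheory.LFunctions
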